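/-
Copyright (c) 2026 the pub-hodgecm-mathlib formalisation cell (harness21).  Prover seat hodgecm-mathlib-K2E4-p14 (g8), Track B ∕ K2-LIT, h413 = `stmt-HodgeConjecture-24833`,
line `K2_E1_TraceFormulaBeta`, campaign «EIS-R7-BL-SPH-3», «CLOSER₃ EXPORTS» FILE X2₃ (dealer K2E1-plan (g6) deals (60)(94)(98)(101)): THE `N = 3` PRINT of K2E1-p13 (g0)'s X2 core
★∕📤 p859664 `K2E1SphericalEisensteinMeromorphicExportsU2Global.sphericalEisenstein_meromorphic_exports_core_cm_two` — the global Bernstein–Lapid export head of `U(2,1)_{L∕L⁺}`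
(core: (E1), (E3), (E4), (E5)), over ★ X1₃ `exists_ball_package_cm_three` (this seat, p859610), ★ brick 2 `cnstN_iota_toHX_eisensteinSeriesU_eq_cm_three` (this seat, p859632), K2E1-p13's
rank-generic ★ X2a `meromorphicOn_coeff_of_system` ∕ `continuous_integral_mul_lift` (p859621) and the `σ₀`-edition ★ `exists_global_pole_set_of_lt 2` (K2E1-p08, ED. 2).
-/
import Summits.HodgeConjecture.HodgeConjecture.Theorems.K2E1SphericalEisensteinMeromorphicExportsU3          -- ★ X1₃ p859610 (this seat): `exists_ball_package_cm_three`; brings ★ closer₃ and the whole `N = 3` kit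
import Summits.HodgeConjecture.HodgeConjecture.Theorems.K2E1SphericalEisensteinConstantTermCoefficientCMThree -- ★ brick 2 p859632 (this seat): `cnstN_iota_toHX_eisensteinSeriesU_eq_cm_three` (S2₃ identified); brings ★ (Ξ₂)₃ `borelConstantTerm_sphericalEisenstein_cm_three`
import Summits.HodgeConjecture.HodgeConjecture.Theorems.K2E1SphericalEisensteinCoefficientCMTwo              -- ★ X2a p859621 (K2E1-p13): RANK-GENERIC `meromorphicOn_coeff_of_system`, `continuous_integral_mul_lift` (imported, not retyped)
import Summits.HodgeConjecture.HodgeConjecture.Theorems.K2E1BLMeromorphicFamilyByproductsU                     -- ★ (K2E1-p08) ED. 2: `exists_global_pole_set_of_lt (σ₀) (n₀)` (NF gluing with a common pole set, Godement half-plane `{σ₀ < re}`, balls `n ≥ n₀`)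
import Summits.HodgeConjecture.HodgeConjecture.Theorems.K2E1SphericalConstantTermContinuationU3                 -- ★ p859428 (this seat, g7): `differentiableOn_intertwiningScalar_cm_three` (`∫ H(ι(w₀)v)^z dν` holomorphic on `{2 < Re}`)
import Summits.HodgeConjecture.HodgeConjecture.Theorems.K2E1SphericalHeckeEigenSectionU2                      -- ★ (a): `differentiable_integral_mul_borelHeight_cpow` (`ĥ` entire, rank `N`)
import HarnessLib

/-!
# «CLOSER₃ EXPORTS», FILE X2₃ — `K2E1SphericalEisensteinMeromorphicExportsU3Global`: the global Bernstein–Lapid export head of `U(2,1)_{L∕L⁺}` (core: (E1), (E3), (E4), (E5)) — the `N = 3` print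

Track B ∕ K2-LIT, crux h413 = `stmt-HodgeConjecture-24833`, route of record `HCCMUnconditional`; cell `hodgecm-mathlib`, squad K2, ENGINE E1.  THEOREMS ONLY (no `def`, no `instance`,
no `notation`, no `sorry`; default heartbeats); lane `--supports stmt-HodgeConjecture-24833 --as helper` (count-neutral).
WHAT.  The statement and proof of K2E1-p13 (g0)'s X2 core `sphericalEisenstein_meromorphic_exports_core_cm_two` LINE FOR LINE with the `U(2,1)` numerology: Godement half-plane
`{2 < Re z}`, second exponent `H^{2−z}`, the `(σ₀, ρ₀) = (2, 2)` editions (★ `exists_global_pole_set_of_lt 2 zero_le_two (n₀ := 1)`; the pole set lies in `{Re ≤ 2}`), no trace-zero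
datum, the `N = 3` kit by name (★ (b1)₃ `eisensteinSeriesU_flatSectionU_memHX_cm_three`, ★ `map_conj_toAdelic_eq_self_three`, ★ regularity `…_cm_three`, ★ (Ξ₂)₃
`borelConstantTerm_sphericalEisenstein_cm_three`, ★ `differentiableOn_intertwiningScalar_cm_three`, ★ brick 2 `cnstN_iota_toHX_eisensteinSeriesU_eq_cm_three`), and ONE indexing change
forced by the `N = 3` ball package ★ X1₃ `exists_ball_package_cm_three (n) (hn : 0 < n)` (the ball `n = 0` does not meet `{2 < Re}`, ★ `hunq_cm_three`): **the per-ball index `n : ℕ` of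
this head names the ball `D_{n+1} = ball 0 ((n+1)+2)` of weight `k = (n+1)+4`** — the exposed families `I η h a κ T U vX cc` at index `n` are ★ X1₃'s objects at `n + 1` VERBATIM (types
`HX … (n + 1 + 4) μ`, `Metric.ball (0 : ℂ) (↑(n + 1) + 2)`), so a consumer working on the ball `m ≥ 1` (e.g. ★∕📤 K2E1-p11's `exists_truncatedFamily_cm_three (m) …`) instantiates `n := m − 1`
and reads the clauses at `m = n + 1` literally; the gluing lemma's ball-indexed holomorphy sets are `n ↦ U (n − 1)`, whence the off-`P` clause
`z ∉ P → 2 < Re z ∨ (z ∈ U (max 1 ⌈‖z‖⌉₊ − 1) ∧ z ∈ U (max 1 (⌈‖z‖⌉₊ + 1) − 1))`.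
From FILE X1₃ (taken at `φ₀` AND at `1`) and ONE call of ★ `exists_global_pole_set_of_lt 2` over the index type `Option G(𝔸)` (`some g ↦` the scalar piece `Ec_g` of the ball;
`none ↦` the ball's `φ₀ = 1` coefficient patched to `c` on the Godement half-plane), with the per-ball holomorphy sets `U n ∩ U₁ n`, we obtain a family `Ec : ℂ → G(𝔸) → ℂ`, a coefficient
`c̃ : ℂ → ℂ` and ONE COMMON pole set `P` (closed, co-discrete, inside `{Re ≤ 2}`) with: `Ec(·)(g)` and `c̃` NORMAL-FORM MEROMORPHIC on `ℂ` and ANALYTIC off `P` ((E1)); `Ec z = E(φ₀H^z)`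
and `c̃ z = c(z) = ν(𝓕)⁻¹∫_{N(𝔸)}H(ι(w₀)v)^z dν` for `2 < Re z`, with the constant-term link `E_B(Ec z)(g) = φ₀(H(g)^z + c̃(z)H(g)^{2−z})` there ((E3), ★ (Ξ₂)₃ identified); `g ↦ Ec z g`
CONTINUOUS for every `z ∉ P` ((E4)); and, ball by ball, FILE X1₃'s whole package TOGETHER WITH (E5) the POINTWISE representation `Ec z g = ĥ_j(z)⁻¹·∫ h_j(y)·vX(z)[(g y)⁻¹] dν_G(y)` at
every `z ∈ U n ∖ P` with `ĥ_j(z) ≠ 0` (NF-germ equality at `z`: the glued function is analytic at `z ∉ P`, the right side is `ĥ_j⁻¹·Λ_{g,j}∘vX` for the ★ P3-D functional, continuous at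
`z`; limits along `𝓝[≠] z` agree).  The identification `cc₁ = c` on `U₁ n ∩ {2 < Re}` is ★ brick 2 (S2₃ identified) against X1₃'s `α`-system (`α₂(z) ≠ 0`); the meromorphy of `cc₁` on
the ball is ★ X2a §1 (rank-generic).  The locally uniform bound (E2) follows K2E1-p13's X2b on its head (its ₃ print on this head).  (E3′) is NOT claimed here.
* §1 HEAD **`sphericalEisenstein_meromorphic_exports_core_cm_three`**.
HONEST LABEL: HC_CM is proved only modulo the 7 printed citations (2 remaining named inputs: hLiu418 = `stmt-HodgeConjecture-24832`, h413 = `stmt-HodgeConjecture-24833`) until rung 0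
closes; this file asserts no named fact, closes no socket; count-neutral; letter-free (structural measure data only, as the closer).
[cite: BernsteinLapid2019, Thm 2.3, §2.1, §2.4 and §4 Claims 1–5 (pp. 9–10)] [cite: MoeglinWaldspurger1995, II.1.7, IV.1.8–IV.1.10] [cite: Langlands1976, §7]

## References
* [BernsteinLapid2019] J. Bernstein, E. Lapid, *On the meromorphic continuation of Eisenstein series*, J. AMS 37 (2024), Thm 2.3, §2, §4.
* [MoeglinWaldspurger1995] C. Mœglin, J.-L. Waldspurger, *Spectral decomposition and Eisenstein series* (1995), II.1.7, IV.1.8–IV.1.10.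
* [Langlands1976] R. P. Langlands, *On the Functional Equations Satisfied by Eisenstein Series*, LNM 544 (1976), §7.
-/

set_option autoImplicit false
set_option linter.dupNamespace false  -- the mandated namespace repeats the summit's segment (`HodgeConjecture.HodgeConjecture`)

noncomputable section

open MeasureTheory Filter Topology Set NumberField
open scoped NNReal ENNReal Classical ComplexConjugate
open Literature.MeasureTheory.Group Literature.NumberTheory Literature.NumberTheory.Automorphic Literature.NumberTheory.Automorphic.UnitaryGroup AdelicGroupData
open Summit.HodgeConjecture.HodgeConjecture.Cruxes.H413.K2E1BorelEisensteinU
open Summit.HodgeConjecture.HodgeConjecture.Cruxes.H413.K2E1BLBorelSpacesU2Defs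
open Summit.HodgeConjecture.HodgeConjecture.Cruxes.H413.K2E1BLBorelOperatorsU2Defs
open Summit.HodgeConjecture.HodgeConjecture.Cruxes.H413.K2E1BLIotaClosedEmbeddingU3 (isFiniteMeasure_weightedTruncMeasure_cm_three)
open Summit.HodgeConjecture.HodgeConjecture.Cruxes.H413.K2E1SphericalEisensteinMeromorphicSuppliersU3 (measure_setOf_lt_ne_top_cm_three)
open Summit.HodgeConjecture.HodgeConjecture.Cruxes.H413.K2E1BLEisensteinMemHXCMThree (eisensteinSeriesU_flatSectionU_memHX_cm_three)
open Summit.HodgeConjecture.HodgeConjecture.Cruxes.H413.K2E1BLFibreAverageInvarianceU (integral_zFun_borelConstantTerm_eq_of_unfolding)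
open Summit.HodgeConjecture.HodgeConjecture.Cruxes.H413.K2E1IntertwinedSectionInvariance (map_conj_toAdelic_eq_self_three)
open Summit.HodgeConjecture.HodgeConjecture.Cruxes.H413.K2E1BLEvaluationFunctionalU2 (exists_evalCLM)
open Summit.HodgeConjecture.HodgeConjecture.Cruxes.H413.K2E1BLLiftIntegrabilityU (quotFun_lift lift_quotientSubgroup_mul)
open Summit.HodgeConjecture.HodgeConjecture.Cruxes.H413.K2E1BLHeightPowerHolomorphicU2 (differentiableOn_HN_of_ae_eq_cpow differentiableOn_HN_of_ae_eq_cpow_self)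
open Summit.HodgeConjecture.HodgeConjecture.Cruxes.H413.K2E1BLMeromorphicFamilyByproductsU (exists_global_pole_set_of_lt)
open Summit.HodgeConjecture.HodgeConjecture.Cruxes.H413.K2E1BorelEisensteinRegularCMThree (differentiableOn_eisensteinSeriesU_flatSectionU_cm_three continuous_eisensteinSeriesU_flatSectionU_cm_three)
open Summit.HodgeConjecture.HodgeConjecture.Cruxes.H413.K2E1SphericalConstantTermContinuationU3 (differentiableOn_intertwiningScalar_cm_three)
open Summit.HodgeConjecture.HodgeConjecture.Cruxes.H413.K2E1SphericalHeckeEigenSectionU2 (differentiable_integral_mul_borelHeight_cpow)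
open Summit.HodgeConjecture.HodgeConjecture.Cruxes.H413.K2E1SphericalEisensteinContinuationU3Final (borelConstantTerm_sphericalEisenstein_cm_three)
open Summit.HodgeConjecture.HodgeConjecture.Cruxes.H413.K2E1SphericalEisensteinMeromorphicExportsU3 (exists_ball_package_cm_three)
open Summit.HodgeConjecture.HodgeConjecture.Cruxes.H413.K2E1SphericalEisensteinCoefficientCMTwo (meromorphicOn_coeff_of_system continuous_integral_mul_lift)
open Summit.HodgeConjecture.HodgeConjecture.Cruxes.H413.K2E1SphericalEisensteinConstantTermCoefficientCMThree (cnstN_iota_toHX_eisensteinSeriesU_eq_cm_three)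

namespace Summit.HodgeConjecture.HodgeConjecture.Cruxes.H413.K2E1SphericalEisensteinMeromorphicExportsU3Global

variable (L : Type) [Field L] [NumberField L] [IsCMField L]
  [MeasurableSpace (quasiSplit (↥(maximalRealSubfield L)) L (IsCMField.complexConj L) 3).Adelic] [BorelSpace (quasiSplit (↥(maximalRealSubfield L)) L (IsCMField.complexConj L) 3).Adelic]

/-- **HEAD (core) — THE GLOBAL BERNSTEIN–LAPID EXPORTS OF `U(2,1)_{L∕L⁺}`** (module docstring; the `N = 3` print of ★ `sphericalEisenstein_meromorphic_exports_core_cm_two`): `∃ Ec P c̃`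
and, ball by ball (index `n` = the ball `D_{n+1}` of weight `(n+1)+4`, ★ X1₃ at `n + 1`), FILE X1₃'s objects, with normal-form meromorphy, the Godement agreement on `{2 < Re}`, `P`
closed ∕ co-discrete ∕ inside `{Re ≤ 2}` ∕ off `P` inside the holomorphy sets `U (max 1 ⌈‖z‖⌉₊ − 1)`, `U (max 1 (⌈‖z‖⌉₊ + 1) − 1)`, (E1) analyticity off `P`, (E4) continuity in `g` off
`P`, (E3) the coefficient `c̃` (normal form, analytic off `P`, `= c` and the constant-term link `φ₀(H^z + c̃ H^{2−z})` on `{2 < Re}`), X1₃'s per-ball package on `U n`, and (E5) the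
pointwise representation `Ec z g = ĥ_j(z)⁻¹·∫ h_j(y)·vX(z)[(g y)⁻¹] dν_G(y)` on `U n ∖ P`. [cite: BernsteinLapid2019, Thm 2.3, §2.4 and §4 Claims 1–5 (pp. 9–10)]
[cite: MoeglinWaldspurger1995, II.1.7, IV.1.8–IV.1.10] -/
theorem sphericalEisenstein_meromorphic_exports_core_cm_three
    -- structural letters: the measures (verbatim as FILE X1₃ ∕ ★ closer₃)
    (μ : Measure (quasiSplit (↥(maximalRealSubfield L)) L (IsCMField.complexConj L) 3).automorphicQuotient) [(quasiSplit (↥(maximalRealSubfield L)) L (IsCMField.complexConj L) 3).IsAutomorphicMeasure μ]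
    (νG : Measure (quasiSplit (↥(maximalRealSubfield L)) L (IsCMField.complexConj L) 3).Adelic) [νG.IsHaarMeasure] [νG.IsInvInvariant] [SFinite νG]
    (ν : Measure ↥(adelicUnipotent (↥(maximalRealSubfield L)) L (IsCMField.complexConj L) 3)) [ν.IsHaarMeasure] [ν.IsMulRightInvariant] [ν.IsInvInvariant]
    {𝓕 : Set ↥(adelicUnipotent (↥(maximalRealSubfield L)) L (IsCMField.complexConj L) 3)}
    (h𝓕N : IsFundamentalDomain ↥(rationalUnipotent (↥(maximalRealSubfield L)) L (IsCMField.complexConj L) 3) 𝓕 ν) (h𝓕c : IsCompact (closure 𝓕)) (h𝓕₀ : ν 𝓕 ≠ 0)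
    {β : (quasiSplit (↥(maximalRealSubfield L)) L (IsCMField.complexConj L) 3).Adelic → ℝ≥0∞}
    (hβ : IsCoveringWeight ↥((arithmeticBorel (↥(maximalRealSubfield L)) L (IsCMField.complexConj L) 3).map (quasiSplit (↥(maximalRealSubfield L)) L (IsCMField.complexConj L) 3).arithmeticSubgroup.subtype) β)
    {μZ : Measure (borelQuotient (↥(maximalRealSubfield L)) L (IsCMField.complexConj L) 3)} [SFinite μZ]
    (hμZ : ∀ f : borelQuotient (↥(maximalRealSubfield L)) L (IsCMField.complexConj L) 3 → ℝ≥0∞, Measurable f → ∫⁻ z, f z ∂μZ = ∫⁻ g, β g * f (toBorelQuotient (↥(maximalRealSubfield L)) L (IsCMField.complexConj L) 3 g) ∂νG)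
    (φ₀ : ℂ) :
    ∃ (Ec : ℂ → (quasiSplit (↥(maximalRealSubfield L)) L (IsCMField.complexConj L) 3).Adelic → ℂ) (P : Set ℂ) (cI : ℂ → ℂ)
      (I : ℕ → Type) (_ : ∀ n, Fintype (I n)) (η : (n : ℕ) → I n → GL (Fin 3) (AdeleRing (𝓞 L) L) → ℝ) (h : (n : ℕ) → I n → (quasiSplit (↥(maximalRealSubfield L)) L (IsCMField.complexConj L) 3).Adelic → ℂ)
      (a : ℕ → ℝ≥0) (κ : (n : ℕ) → I n → ℝ≥0) (T : (n : ℕ) → I n → HX (↥(maximalRealSubfield L)) L (IsCMField.complexConj L) 3 (n + 1 + 4) μ →L[ℂ] HX (↥(maximalRealSubfield L)) L (IsCMField.complexConj L) 3 (n + 1 + 4) μ) (U : ℕ → Set ℂ)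
      (vX : (n : ℕ) → ℂ → HX (↥(maximalRealSubfield L)) L (IsCMField.complexConj L) 3 (n + 1 + 4) μ) (cc : ℕ → ℂ → ℂ),
      -- GLOBAL: normal-form meromorphy, the Godement agreement on `{2 < Re}`, the pole set `P` (closed, co-discrete, inside `{Re ≤ 2}`, off `P` one is in the holomorphy sets of the balls `max 1 ⌈‖z‖⌉₊` and `+ 1`)
      (∀ g, MeromorphicNFOn (fun z => Ec z g) univ) ∧ (∀ z : ℂ, 2 < z.re → Ec z = eisensteinSeriesU (flatSectionU (fun _ : (quasiSplit (↥(maximalRealSubfield L)) L (IsCMField.complexConj L) 3).Adelic => φ₀) z)) ∧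
      IsClosed P ∧ (∀ z₀ : ℂ, ∀ᶠ s in 𝓝[≠] z₀, s ∉ P) ∧ (∀ z ∈ P, z.re ≤ 2) ∧
      (∀ z : ℂ, z ∉ P → 2 < z.re ∨ (z ∈ U (max 1 ⌈‖z‖⌉₊ - 1) ∧ z ∈ U (max 1 (⌈‖z‖⌉₊ + 1) - 1))) ∧
      -- (E1) analytic off `P`; (E4) continuous in `g` off `P`
      (∀ g (z : ℂ), z ∉ P → AnalyticAt ℂ (fun z => Ec z g) z) ∧ (∀ z : ℂ, z ∉ P → Continuous (Ec z)) ∧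
      -- (E3) the constant-term coefficient `cI`: normal-form meromorphic on `ℂ`, analytic off `P`, `= c` on `{2 < Re}`, and the constant-term link there
      MeromorphicNFOn cI univ ∧ (∀ z : ℂ, z ∉ P → AnalyticAt ℂ cI z) ∧ (∀ z : ℂ, 2 < z.re → cI z = ((((ν 𝓕).toReal⁻¹ : ℝ)) : ℂ) * (∫ v : ↥(adelicUnipotent (↥(maximalRealSubfield L)) L (IsCMField.complexConj L) 3), (((borelHeight ((quasiSplit (↥(maximalRealSubfield L)) L (IsCMField.complexConj L) 3).toAdelic (weylLongU ((IsCMField.complexConj L : L ≃ₐ[↥(maximalRealSubfield L)] L) : L →+* L) (rfl : (StdForm.antidiagonal 3).over L = (StdForm.antidiagonal 3).over L)) * (v : (quasiSplit (↥(maximalRealSubfield L)) L (IsCMField.complexConj L) 3).Adelic)) : ℝ) : ℂ) ^ z) ∂ν)) ∧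
      (∀ z : ℂ, 2 < z.re → ∀ g : (quasiSplit (↥(maximalRealSubfield L)) L (IsCMField.complexConj L) 3).Adelic, borelConstantTerm ν 𝓕 (Ec z) g = φ₀ * (((borelHeight g : ℝ) : ℂ) ^ z + cI z * ((borelHeight g : ℝ) : ℂ) ^ (2 - z))) ∧
      -- PER BALL `D_{n+1} = ball 0 ((n+1)+2)` (weight `(n+1)+4`; index `n` = ★ X1₃ at `n + 1`): FILE X1₃'s package ((R1), `h = S_η η`, regularity, cover, (R3), (R2), `U n`, `vX n`, `cc n`,
      -- Godement on `{2 < Re}`, eigen, `α`-system with `α₂ = [H^{2−z}]`) and (E5) THE POINTWISE REPRESENTATION of the global `Ec` in X1₃'s integral currency at every `z ∈ U n ∖ P` with `ĥ_j(z) ≠ 0`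
      ∀ n : ℕ,
        (∀ i, IsTestFunctionGL 3 L (η n i) ∧ (∀ g, 0 ≤ η n i g) ∧ (∀ g, η n i g⁻¹ = η n i g) ∧
          ∀ k₁ k₂ : (quasiSplit (↥(maximalRealSubfield L)) L (IsCMField.complexConj L) 3).Adelic, adelicVal (↥(maximalRealSubfield L)) L (IsCMField.complexConj L) 3 ((StdForm.antidiagonal 3).over L) k₁ ∈ standardMaximalCompactGL 3 L → adelicVal (↥(maximalRealSubfield L)) L (IsCMField.complexConj L) 3 ((StdForm.antidiagonal 3).over L) k₂ ∈ standardMaximalCompactGL 3 L →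
              ∀ x, η n i (adelicVal (↥(maximalRealSubfield L)) L (IsCMField.complexConj L) 3 ((StdForm.antidiagonal 3).over L) (k₁ * x * k₂)) = η n i (adelicVal (↥(maximalRealSubfield L)) L (IsCMField.complexConj L) 3 ((StdForm.antidiagonal 3).over L) x)) ∧
        (∀ i, h n i = fun y : (quasiSplit (↥(maximalRealSubfield L)) L (IsCMField.complexConj L) 3).Adelic => orbitalSmoothing νG (fun x : (quasiSplit (↥(maximalRealSubfield L)) L (IsCMField.complexConj L) 3).Adelic => ((η n i (adelicVal (↥(maximalRealSubfield L)) L (IsCMField.complexConj L) 3 ((StdForm.antidiagonal 3).over L) x) : ℝ) : ℂ)) (fun x : (quasiSplit (↥(maximalRealSubfield L)) L (IsCMField.complexConj L) 3).Adelic => ((η n i (adelicVal (↥(maximalRealSubfield L)) L (IsCMField.complexConj L) 3 ((StdForm.antidiagonal 3).over L) x) : ℝ) : ℂ)) y) ∧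
        (∀ i, Continuous (h n i) ∧ HasCompactSupport (h n i) ∧
          (∀ k₀ : (quasiSplit (↥(maximalRealSubfield L)) L (IsCMField.complexConj L) 3).Adelic, adelicVal (↥(maximalRealSubfield L)) L (IsCMField.complexConj L) 3 ((StdForm.antidiagonal 3).over L) k₀ ∈ standardMaximalCompactGL 3 L → ∀ x, h n i (k₀ * x) = h n i x) ∧
          (∀ g, h n i g⁻¹ = h n i g) ∧ (∀ g, conj (h n i g) = h n i g) ∧ (∀ g, 0 ≤ (h n i g).re)) ∧
        (∀ z ∈ Metric.ball (0 : ℂ) (((n + 1 : ℕ) : ℝ) + 2), ∃ i, (∫ x, h n i x * (((borelHeight x : ℝ≥0) : ℝ) : ℂ) ^ z ∂νG) ≠ 0) ∧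
        0 < a n ∧ (∀ i, 1 ≤ κ n i) ∧
        (∀ i, ∀ z : borelQuotient (↥(maximalRealSubfield L)) L (IsCMField.complexConj L) 3, ∀ y ∈ tsupport (h n i), borelQuotHeight (↥(maximalRealSubfield L)) L (IsCMField.complexConj L) 3 z ≤ κ n i * borelQuotHeight (↥(maximalRealSubfield L)) L (IsCMField.complexConj L) 3 (rightShift (↥(maximalRealSubfield L)) L (IsCMField.complexConj L) 3 y z)) ∧
        (∀ i, ∀ u : HX (↥(maximalRealSubfield L)) L (IsCMField.complexConj L) 3 (n + 1 + 4) μ, (T n i u : (quasiSplit (↥(maximalRealSubfield L)) L (IsCMField.complexConj L) 3).automorphicQuotient → ℂ) =ᵐ[(μ.withDensity fun x => (((supHeight (↥(maximalRealSubfield L)) L (IsCMField.complexConj L) 3 x)⁻¹ ^ (2 * (n + 1 + 4)) : ℝ≥0) : ℝ≥0∞))]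
            fun ξ => ∫ y, h n i y * (u : (quasiSplit (↥(maximalRealSubfield L)) L (IsCMField.complexConj L) 3).automorphicQuotient → ℂ) (y⁻¹ • ξ) ∂νG) ∧
        IsOpen (U n) ∧ U n ⊆ Metric.ball (0 : ℂ) (((n + 1 : ℕ) : ℝ) + 2) ∧ Metric.ball (0 : ℂ) (((n + 1 : ℕ) : ℝ) + 2) ⊆ closure (U n) ∧ (∀ z₀ ∈ Metric.ball (0 : ℂ) (((n + 1 : ℕ) : ℝ) + 2), ∀ᶠ s in 𝓝[≠] z₀, s ∈ U n) ∧
        DifferentiableOn ℂ (vX n) (U n) ∧ MeromorphicOn (vX n) (Metric.ball (0 : ℂ) (((n + 1 : ℕ) : ℝ) + 2)) ∧ DifferentiableOn ℂ (cc n) (U n) ∧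
        (∀ z ∈ U n, 2 < z.re → ((vX n z : HX (↥(maximalRealSubfield L)) L (IsCMField.complexConj L) 3 (n + 1 + 4) μ) : (quasiSplit (↥(maximalRealSubfield L)) L (IsCMField.complexConj L) 3).automorphicQuotient → ℂ) =ᵐ[(μ.withDensity fun x => (((supHeight (↥(maximalRealSubfield L)) L (IsCMField.complexConj L) 3 x)⁻¹ ^ (2 * (n + 1 + 4)) : ℝ≥0) : ℝ≥0∞))] (quasiSplit (↥(maximalRealSubfield L)) L (IsCMField.complexConj L) 3).quotFun (eisensteinSeriesU (flatSectionU (fun _ : (quasiSplit (↥(maximalRealSubfield L)) L (IsCMField.complexConj L) 3).Adelic => φ₀) z))) ∧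
        (∀ z ∈ U n, ∀ i, T n i (vX n z) = (∫ x, h n i x * (((borelHeight x : ℝ≥0) : ℝ) : ℂ) ^ z ∂νG) • vX n z) ∧
        (∃ (hb : IotaBound (↥(maximalRealSubfield L)) L (IsCMField.complexConj L) 3 (n + 1 + 4) (a n) μ μZ) (α₁ α₂ : ℂ → HN (↥(maximalRealSubfield L)) L (IsCMField.complexConj L) 3 (n + 1 + 4) (a n) μZ),
          (∀ z ∈ Metric.ball (0 : ℂ) (((n + 1 : ℕ) : ℝ) + 2), (α₁ z : borelQuotient (↥(maximalRealSubfield L)) L (IsCMField.complexConj L) 3 → ℂ) =ᵐ[weightedTruncMeasure (↥(maximalRealSubfield L)) L (IsCMField.complexConj L) 3 (n + 1 + 4) (a n) μZ] fun x => (((borelQuotHeight (↥(maximalRealSubfield L)) L (IsCMField.complexConj L) 3 x : ℝ≥0) : ℝ) : ℂ) ^ z) ∧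
          (∀ z ∈ Metric.ball (0 : ℂ) (((n + 1 : ℕ) : ℝ) + 2), (α₂ z : borelQuotient (↥(maximalRealSubfield L)) L (IsCMField.complexConj L) 3 → ℂ) =ᵐ[weightedTruncMeasure (↥(maximalRealSubfield L)) L (IsCMField.complexConj L) 3 (n + 1 + 4) (a n) μZ] fun x => (((borelQuotHeight (↥(maximalRealSubfield L)) L (IsCMField.complexConj L) 3 x : ℝ≥0) : ℝ) : ℂ) ^ (2 - z)) ∧
          (∀ z ∈ Metric.ball (0 : ℂ) (((n + 1 : ℕ) : ℝ) + 2), α₂ z ≠ 0) ∧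
          ∀ z ∈ U n, cnstN (↥(maximalRealSubfield L)) L (IsCMField.complexConj L) 3 (n + 1 + 4) (a n) μZ (iota hb (vX n z)) = φ₀ • α₁ z + cc n z • α₂ z) ∧
        (∀ j, ∀ z ∈ U n, z ∉ P → (∫ x, h n j x * (((borelHeight x : ℝ≥0) : ℝ) : ℂ) ^ z ∂νG) ≠ 0 →
          ∀ g : (quasiSplit (↥(maximalRealSubfield L)) L (IsCMField.complexConj L) 3).Adelic, Ec z g = (∫ x, h n j x * (((borelHeight x : ℝ≥0) : ℝ) : ℂ) ^ z ∂νG)⁻¹ * ∫ y, h n j y * ((vX n z : HX (↥(maximalRealSubfield L)) L (IsCMField.complexConj L) 3 (n + 1 + 4) μ) : (quasiSplit (↥(maximalRealSubfield L)) L (IsCMField.complexConj L) 3).automorphicQuotient → ℂ) ((quasiSplit (↥(maximalRealSubfield L)) L (IsCMField.complexConj L) 3).toAutomorphicQuotient (g * y)⁻¹) ∂νG) := by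
  classical
  -- involution facts (no trace-zero datum is needed at `N = 3`), finiteness of `ν 𝓕`
  have hc : IsCMField.complexConj L * IsCMField.complexConj L = 1 :=
    AlgEquiv.ext fun x => by rw [AlgEquiv.mul_apply, AlgEquiv.one_apply, IsCMField.complexConj_apply_apply]
  have hc1 : IsCMField.complexConj L ≠ 1 := IsCMField.complexConj_ne_one L
  have h𝓕top : ν 𝓕 ≠ ∞ := ((measure_mono subset_closure).trans_lt h𝓕c.measure_lt_top).ne
  haveI : νG.IsMulRightInvariant := by rw [← Measure.inv_eq_self νG]; infer_instance
  -- ── the two per-ball packages of FILE X1₃ (at `φ₀`, and at `1` for the coefficient), chosen over `n` (index `n` ↦ the ball `n + 1`, X1₃'s `hn := n.succ_pos`) ──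
  have P0 := fun n : ℕ => exists_ball_package_cm_three L μ νG ν h𝓕N h𝓕c h𝓕₀ hβ hμZ φ₀ (n + 1) n.succ_pos
  choose I hI η h a κ T U vX cc hη hhdef hreg hcov ha hκ1 hdist hT hUo hUD _hDcl hUcd hvXd hvXm hccd hgod heig hαsys hR4 using P0
  choose hb α₁ α₂ hα₁ hα₂ hα₂ne hsys using hαsys
  choose Ecb hEcm hEcg hEco hgerm using hR4
  have P1 := fun n : ℕ => exists_ball_package_cm_three L μ νG ν h𝓕N h𝓕c h𝓕₀ hβ hμZ 1 (n + 1) n.succ_pos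
  choose _I₁ _hI₁ _η₁ _h₁ a₁ _κ₁ _T₁ U₁ vX₁ cc₁ _e₁ _e₂ _e₃ _e₄ ha₁ _e₆ _e₇ _e₈ hUo₁ hUD₁ _e₉ hUcd₁ _e₁₀ hvXm₁ hccd₁ hgod₁ _e₁₁ hαsys₁ _e₁₂ using P1
  choose hb₁ α₁' α₂' hα₁' hα₂' hα₂ne' hsys₁ using hαsys₁
  -- ── (E3) per ball: the `φ₀ = 1` coefficient `cc₁ n` IS `c` on `U₁ n ∩ {2 < Re}` (★ brick 2 S2₃ identified + `α₂ ≠ 0`) and is MEROMORPHIC on the ball (★ X2a §1, rank-generic) ──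
  have hzF : ∀ w : ℂ, zFun (↥(maximalRealSubfield L)) L (IsCMField.complexConj L) 3 (fun g : (quasiSplit (↥(maximalRealSubfield L)) L (IsCMField.complexConj L) 3).Adelic => (((borelHeight g : ℝ)) : ℂ) ^ w) = fun x => (((borelQuotHeight (↥(maximalRealSubfield L)) L (IsCMField.complexConj L) 3 x : ℝ≥0) : ℝ) : ℂ) ^ w := by
    intro w
    funext x
    obtain ⟨g₁, rfl⟩ : ∃ g₁, toBorelQuotient (↥(maximalRealSubfield L)) L (IsCMField.complexConj L) 3 g₁ = x := Quotient.exists_rep x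
    refine zFun_toBorelQuotient (↥(maximalRealSubfield L)) L (IsCMField.complexConj L) 3 (fun γ hγ g' => ?_) g₁
    obtain ⟨γ₀, hγ₀, hγ₀B⟩ := exists_eq_toAdelic_of_mem_ratBorelSubgroup (↥(maximalRealSubfield L)) L (IsCMField.complexConj L) 3 hγ
    simp only [← hγ₀, borelHeight_rational_borel_mul γ₀ hγ₀B]
  have hzk : ∀ n : ℕ, ∀ z ∈ Metric.ball (0 : ℂ) (((n + 1 : ℕ) : ℝ) + 2), z.re ≤ ((n + 1 + 4 : ℕ) : ℝ) := fun n z hz => by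
    have h1 : z.re ≤ ‖z‖ := Complex.re_le_norm z
    have h2 : ‖z‖ < ((n + 1 : ℕ) : ℝ) + 2 := mem_ball_zero_iff.1 hz
    push_cast at h2 ⊢
    linarith
  have hid₁ : ∀ n : ℕ, ∀ z ∈ U₁ n, 2 < z.re → cc₁ n z = ((((ν 𝓕).toReal⁻¹ : ℝ)) : ℂ) * (∫ v : ↥(adelicUnipotent (↥(maximalRealSubfield L)) L (IsCMField.complexConj L) 3), (((borelHeight ((quasiSplit (↥(maximalRealSubfield L)) L (IsCMField.complexConj L) 3).toAdelic (weylLongU ((IsCMField.complexConj L : L ≃ₐ[↥(maximalRealSubfield L)] L) : L →+* L) (rfl : (StdForm.antidiagonal 3).over L = (StdForm.antidiagonal 3).over L)) * (v : (quasiSplit (↥(maximalRealSubfield L)) L (IsCMField.complexConj L) 3).Adelic)) : ℝ) : ℂ) ^ z) ∂ν) := by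
    intro n z hzU hz1
    have hzb := hUD₁ n hzU
    haveI := isFiniteMeasure_weightedTruncMeasure_cm_three L μ νG hβ hμZ (ha₁ n) (n + 1 + 4)
    have hE : MemLp ((quasiSplit (↥(maximalRealSubfield L)) L (IsCMField.complexConj L) 3).quotFun (eisensteinSeriesU (flatSectionU (fun _ : (quasiSplit (↥(maximalRealSubfield L)) L (IsCMField.complexConj L) 3).Adelic => 1) z))) 2 (μ.withDensity fun x => (((supHeight (↥(maximalRealSubfield L)) L (IsCMField.complexConj L) 3 x)⁻¹ ^ (2 * (n + 1 + 4)) : ℝ≥0) : ℝ≥0∞)) := eisensteinSeriesU_flatSectionU_memHX_cm_three L ν h𝓕N h𝓕c μ 1 (n + 1 + 4) hz1 (hzk n z hzb)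
    have hαF₁ : MemLp (zFun (↥(maximalRealSubfield L)) L (IsCMField.complexConj L) 3 (fun g : (quasiSplit (↥(maximalRealSubfield L)) L (IsCMField.complexConj L) 3).Adelic => (((borelHeight g : ℝ)) : ℂ) ^ z)) 2 (weightedTruncMeasure (↥(maximalRealSubfield L)) L (IsCMField.complexConj L) 3 (n + 1 + 4) (a₁ n) μZ) := by
      rw [hzF]; exact (Lp.memLp (α₁' n z)).ae_eq (hα₁' n z hzb)
    have hαF₂ : MemLp (zFun (↥(maximalRealSubfield L)) L (IsCMField.complexConj L) 3 (fun g : (quasiSplit (↥(maximalRealSubfield L)) L (IsCMField.complexConj L) 3).Adelic => (((borelHeight g : ℝ)) : ℂ) ^ (2 - z))) 2 (weightedTruncMeasure (↥(maximalRealSubfield L)) L (IsCMField.complexConj L) 3 (n + 1 + 4) (a₁ n) μZ) := by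
      rw [hzF]; exact (Lp.memLp (α₂' n z)).ae_eq (hα₂' n z hzb)
    have hS2 := cnstN_iota_toHX_eisensteinSeriesU_eq_cm_three L ν h𝓕N h𝓕c (hb₁ n)
      (fun Φ hΦm hΦB hint hint' => integral_zFun_borelConstantTerm_eq_of_unfolding νG ν (fun _ hb₀ => map_conj_toAdelic_eq_self_three hc hc1 ν hb₀) h𝓕N h𝓕₀ h𝓕top hβ hμZ (n + 1 + 4) (a₁ n) hΦm hΦB hint hint')
      1 hz1 hE hαF₁ hαF₂
    have hv : vX₁ n z = toHX (↥(maximalRealSubfield L)) L (IsCMField.complexConj L) 3 (n + 1 + 4) μ (eisensteinSeriesU (flatSectionU (fun _ : (quasiSplit (↥(maximalRealSubfield L)) L (IsCMField.complexConj L) 3).Adelic => 1) z)) hE := Lp.ext ((hgod₁ n z hzU hz1).trans (MemLp.coeFn_toLp _).symm)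
    have h₁ : toHN (↥(maximalRealSubfield L)) L (IsCMField.complexConj L) 3 (n + 1 + 4) (a₁ n) μZ (fun g : (quasiSplit (↥(maximalRealSubfield L)) L (IsCMField.complexConj L) 3).Adelic => (((borelHeight g : ℝ)) : ℂ) ^ z) hαF₁ = α₁' n z :=
      Lp.ext ((coeFn_toHN (↥(maximalRealSubfield L)) L (IsCMField.complexConj L) 3 (n + 1 + 4) (a₁ n) μZ _ hαF₁).trans (by rw [hzF]; exact (hα₁' n z hzb).symm))
    have h₂ : toHN (↥(maximalRealSubfield L)) L (IsCMField.complexConj L) 3 (n + 1 + 4) (a₁ n) μZ (fun g : (quasiSplit (↥(maximalRealSubfield L)) L (IsCMField.complexConj L) 3).Adelic => (((borelHeight g : ℝ)) : ℂ) ^ (2 - z)) hαF₂ = α₂' n z :=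
      Lp.ext ((coeFn_toHN (↥(maximalRealSubfield L)) L (IsCMField.complexConj L) 3 (n + 1 + 4) (a₁ n) μZ _ hαF₂).trans (by rw [hzF]; exact (hα₂' n z hzb).symm))
    rw [← hv, h₁, h₂, hsys₁ n z hzU, one_mul] at hS2
    have e2 : (cc₁ n z - ((((ν 𝓕).toReal⁻¹ : ℝ)) : ℂ) * (∫ v : ↥(adelicUnipotent (↥(maximalRealSubfield L)) L (IsCMField.complexConj L) 3), (((borelHeight ((quasiSplit (↥(maximalRealSubfield L)) L (IsCMField.complexConj L) 3).toAdelic (weylLongU ((IsCMField.complexConj L : L ≃ₐ[↥(maximalRealSubfield L)] L) : L →+* L) (rfl : (StdForm.antidiagonal 3).over L = (StdForm.antidiagonal 3).over L)) * (v : (quasiSplit (↥(maximalRealSubfield L)) L (IsCMField.complexConj L) 3).Adelic)) : ℝ) : ℂ) ^ z) ∂ν)) • α₂' n z = 0 := by rw [sub_smul, add_left_cancel hS2, sub_self]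
    exact sub_eq_zero.1 ((smul_eq_zero.1 e2).resolve_right (hα₂ne' n z hzb))
  have hccm : ∀ n : ℕ, MeromorphicOn (cc₁ n) (Metric.ball (0 : ℂ) (((n + 1 : ℕ) : ℝ) + 2)) := by
    intro n
    have hfin₁ : μZ {z | a₁ n < borelQuotHeight (↥(maximalRealSubfield L)) L (IsCMField.complexConj L) 3 z} ≠ ∞ := measure_setOf_lt_ne_top_cm_three L μ νG hβ hμZ (ha₁ n)
    have hre : ∀ z ∈ Metric.ball (0 : ℂ) (((n + 1 : ℕ) : ℝ) + 2), |z.re| < n + 3 := fun z hz => by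
      have h2 : ‖z‖ < ((n + 1 : ℕ) : ℝ) + 2 := mem_ball_zero_iff.1 hz
      push_cast at h2
      linarith [Complex.abs_re_le_norm z]
    have hα₁d : DifferentiableOn ℂ (α₁' n) (Metric.ball (0 : ℂ) (((n + 1 : ℕ) : ℝ) + 2)) :=
      differentiableOn_HN_of_ae_eq_cpow_self (σ₀ := -((n : ℝ) + 3)) (σ₁ := (n : ℝ) + 3) (ha₁ n) hfin₁ (by push_cast; linarith) (by push_cast; linarith) Metric.isOpen_ball
        (fun z hz => ⟨by linarith [(abs_lt.1 (hre z hz)).1], by linarith [(abs_lt.1 (hre z hz)).2]⟩) (hα₁' n)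
    have hα₂d : DifferentiableOn ℂ (α₂' n) (Metric.ball (0 : ℂ) (((n + 1 : ℕ) : ℝ) + 2)) :=
      differentiableOn_HN_of_ae_eq_cpow (φ := fun z : ℂ => 2 - z) (σ₀ := -((n : ℝ) + 1)) (σ₁ := (n : ℝ) + 5) (ha₁ n) hfin₁ (by push_cast; linarith) (by push_cast; linarith) Metric.isOpen_ball
        ((differentiableOn_const _).sub differentiableOn_id)
        (fun z hz => by
          simp only [Complex.sub_re, Complex.re_ofNat]
          exact ⟨by linarith [(abs_lt.1 (hre z hz)).2], by linarith [(abs_lt.1 (hre z hz)).1]⟩) (hα₂' n)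
    exact meromorphicOn_coeff_of_system Metric.isOpen_ball (hUcd₁ n) ((cnstN (↥(maximalRealSubfield L)) L (IsCMField.complexConj L) 3 (n + 1 + 4) (a₁ n) μZ).comp (iota (hb₁ n))) (hvXm₁ n) hα₁d hα₂d (hα₂ne' n) 1
      (fun z hz => by rw [ContinuousLinearMap.comp_apply]; exact hsys₁ n z hz)
  -- the patched coefficient `= c` on the Godement part agrees with `cc₁ n` on punctured neighbourhoods (co-discreteness of `U₁ n`)
  have hpatch : ∀ n : ℕ, ∀ z ∈ Metric.ball (0 : ℂ) (((n + 1 : ℕ) : ℝ) + 2), cc₁ n =ᶠ[𝓝[≠] z] fun s => if 2 < s.re then ((((ν 𝓕).toReal⁻¹ : ℝ)) : ℂ) * (∫ v : ↥(adelicUnipotent (↥(maximalRealSubfield L)) L (IsCMField.complexConj L) 3), (((borelHeight ((quasiSplit (↥(maximalRealSubfield L)) L (IsCMField.complexConj L) 3).toAdelic (weylLongU ((IsCMField.complexConj L : L ≃ₐ[↥(maximalRealSubfield L)] L) : L →+* L) (rfl : (StdForm.antidiagonal 3).over L = (StdForm.antidiagonal 3).over L)) * (v : (quasiSplit (↥(maximalRealSubfield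 L)) L (IsCMField.complexConj L) 3).Adelic)) : ℝ) : ℂ) ^ s) ∂ν) else cc₁ n s := fun n z hz => by
    filter_upwards [hUcd₁ n z hz] with s hs
    by_cases h1 : 2 < s.re
    · rw [if_pos h1]; exact hid₁ n s hs h1
    · rw [if_neg h1]
  -- ── ONE gluing call ★ `exists_global_pole_set_of_lt 2 (n₀ := 1)` over `Option G(𝔸)`: `some g ↦ Ec_g`, `none ↦` the patched coefficient; ball-indexed holomorphy sets `m ↦ U (m−1) ∩ U₁ (m−1)` ──
  obtain ⟨gf, hgf⟩ : ∃ gf : Option (quasiSplit (↥(maximalRealSubfield L)) L (IsCMField.complexConj L) 3).Adelic → ℂ → ℂ, gf = fun o z => Option.elim o (((((ν 𝓕).toReal⁻¹ : ℝ)) : ℂ) * (∫ v : ↥(adelicUnipotent (↥(maximalRealSubfield L)) L (IsCMField.complexConj L) 3), (((borelHeight ((quasiSplit (↥(maximalRealSubfield L)) L (IsCMField.complexConj L) 3).toAdelic (weylLongU ((IsCMField.complexConj L : L ≃ₐ[↥(maximalRealSubfield L)] L) : L →+* L) (rfl : (StdForm.antidiagonal 3).over L = (StdForm.antidiagonal 3).over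 L)) * (v : (quasiSplit (↥(maximalRealSubfield L)) L (IsCMField.complexConj L) 3).Adelic)) : ℝ) : ℂ) ^ z) ∂ν)) (fun g => eisensteinSeriesU (flatSectionU (fun _ : (quasiSplit (↥(maximalRealSubfield L)) L (IsCMField.complexConj L) 3).Adelic => φ₀) z) g) := ⟨_, rfl⟩
  obtain ⟨Fb, hFb⟩ : ∃ Fb : Option (quasiSplit (↥(maximalRealSubfield L)) L (IsCMField.complexConj L) 3).Adelic → ℕ → ℂ → ℂ, Fb = fun o n z => Option.elim o (if 2 < z.re then ((((ν 𝓕).toReal⁻¹ : ℝ)) : ℂ) * (∫ v : ↥(adelicUnipotent (↥(maximalRealSubfield L)) L (IsCMField.complexConj L) 3), (((borelHeight ((quasiSplit (↥(maximalRealSubfield L)) L (IsCMField.complexConj L) 3).toAdelic (weylLongU ((IsCMField.complexConj L : L ≃ₐ[↥(maximalRealSubfield L)] L) : L →+* L) (rfl : (StdForm.antidiagonal 3).over L = (StdForm.antidiagonal 3).over L)) * (v : (quasiSplit (↥(maximalRealSubfield L)) L (IsCMField.complexConj L) 3).Adelic)) : ℝ) : ℂ) ^ z) ∂ν) else cc₁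 n z) (fun g => Ecb n g z) := ⟨_, rfl⟩
  have hg' : ∀ o, DifferentiableOn ℂ (gf o) {z : ℂ | 2 < z.re} := by
    rintro (_ | g)
    · simp only [hgf, Option.elim_none]; exact (differentiableOn_intertwiningScalar_cm_three L ν h𝓕N h𝓕c).const_mul _
    · simp only [hgf, Option.elim_some]; exact differentiableOn_eisensteinSeriesU_flatSectionU_cm_three L (φ := fun _ => φ₀) (M := ‖φ₀‖) (fun _ => le_rfl) g
  have hF' : ∀ o (n : ℕ), MeromorphicOn (Fb o n) (Metric.ball (0 : ℂ) (((n + 1 : ℕ) : ℝ) + 2)) := by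
    rintro (_ | g) n
    · simp only [hFb, Option.elim_none]; exact fun z hz => (hccm n z hz).congr (hpatch n z hz)
    · simp only [hFb, Option.elim_some]; exact hEcm n g
  have hFg' : ∀ o (n : ℕ), ∀ z ∈ Metric.ball (0 : ℂ) (((n + 1 : ℕ) : ℝ) + 2), 2 < z.re → Fb o n z = gf o z := by
    rintro (_ | g) n z hz hz1
    · simp only [hFb, hgf, Option.elim_none, if_pos hz1]
    · simp only [hFb, hgf, Option.elim_some, hEcg n g z hz hz1]
  have hord' : ∀ o (n : ℕ), ∀ z ∈ Metric.ball (0 : ℂ) (((n + 1 : ℕ) : ℝ) + 2), z ∈ U n ∩ U₁ n → 0 ≤ meromorphicOrderAt (Fb o n) z := by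
    rintro (_ | g) n z hz hzU
    · simp only [hFb, Option.elim_none]
      rw [← meromorphicOrderAt_congr (hpatch n z hz)]
      exact ((hccd₁ n).analyticAt ((hUo₁ n).mem_nhds hzU.2)).meromorphicOrderAt_nonneg
    · simp only [hFb, Option.elim_some]; exact hEco n g z hzU.1
  -- re-index by the ball: the lemma's index `m ≥ 1` is the ball `ball 0 (m+2)`, carried here by `n = m − 1`
  have hidx : ∀ m : ℕ, 1 ≤ m → ∃ n : ℕ, m = n + 1 := fun m hm => ⟨m - 1, (Nat.sub_add_cancel hm).symm⟩
  obtain ⟨Gf, P, hGNF, hGg, hGF, hPc, hPcd, hPre, hPU, hGan, -⟩ :=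
    exists_global_pole_set_of_lt 2 zero_le_two 1 (by norm_num) hg' (U := fun m => U (m - 1) ∩ U₁ (m - 1)) (F := fun o m => Fb o (m - 1))
      (fun m hm z₀ hz₀ => by
        obtain ⟨n, rfl⟩ := hidx m hm
        simp only [Nat.add_sub_cancel]
        exact (hUcd n z₀ hz₀).and (hUcd₁ n z₀ hz₀))
      (fun o m hm => by
        obtain ⟨n, rfl⟩ := hidx m hm
        simp only [Nat.add_sub_cancel]
        exact hF' o n)
      (fun o m hm z hz hz1 => by
        obtain ⟨n, rfl⟩ := hidx m hm
        simp only [Nat.add_sub_cancel]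
        exact hFg' o n z hz hz1)
      (fun o m hm z hz hzU => by
        obtain ⟨n, rfl⟩ := hidx m hm
        simp only [Nat.add_sub_cancel] at hzU ⊢
        exact hord' o n z hz hzU)
  -- the Godement agreement of the glued family, as functions of `g`
  have hEcE : ∀ z : ℂ, 2 < z.re → (fun g => Gf (some g) z) = eisensteinSeriesU (flatSectionU (fun _ : (quasiSplit (↥(maximalRealSubfield L)) L (IsCMField.complexConj L) 3).Adelic => φ₀) z) := fun z hz =>
    funext fun g => by rw [hGg (some g) z hz]; simp only [hgf, Option.elim_some]
  have hcc : ∀ z : ℂ, 2 < z.re → Gf none z = ((((ν 𝓕).toReal⁻¹ : ℝ)) : ℂ) * (∫ v : ↥(adelicUnipotent (↥(maximalRealSubfield L)) L (IsCMField.complexConj L) 3), (((borelHeight ((quasiSplit (↥(maximalRealSubfield L)) L (IsCMField.complexConj L) 3).toAdelic (weylLongU ((IsCMField.complexConj L : L ≃ₐ[↥(maximalRealSubfield L)] L) : L →+* L) (rfl : (StdForm.antidiagonal 3).over L = (StdForm.antidiagonal 3).over L)) * (v : (quasiSplit (↥(maximalRealSubfield L)) L (IsCMField.complexConj L) 3).Adelic))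 : ℝ) : ℂ) ^ z) ∂ν) := fun z hz => by rw [hGg none z hz]; simp only [hgf, Option.elim_none]
  -- ── (E5) THE POINTWISE REPRESENTATION at `z ∈ (U n ∩ U₁ n) ∖ P` with `ĥ_j(z) ≠ 0`: NF-germ equality AT `z` (both sides continuous at `z`, limits along `𝓝[≠] z`) ──
  have hE5 : ∀ (n : ℕ) (j : I n), ∀ z ∈ U n ∩ U₁ n, z ∉ P → (∫ x, h n j x * (((borelHeight x : ℝ≥0) : ℝ) : ℂ) ^ z ∂νG) ≠ 0 →
      ∀ g : (quasiSplit (↥(maximalRealSubfield L)) L (IsCMField.complexConj L) 3).Adelic, Gf (some g) z = (∫ x, h n j x * (((borelHeight x : ℝ≥0) : ℝ) : ℂ) ^ z ∂νG)⁻¹ * ∫ y, h n j y * ((vX n z : HX (↥(maximalRealSubfield L)) L (IsCMField.complexConj L) 3 (n + 1 + 4) μ) : (quasiSplit (↥(maximalRealSubfield L)) L (IsCMField.complexConj L) 3).automorphicQuotient → ℂ) ((quasiSplit (↥(maximalRealSubfield L)) L (IsCMField.complexConj L) 3).toAutomorphicQuotient (g * y)⁻¹) ∂νG := by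
    intro n j z hzU hzP hne g
    have hzb : z ∈ Metric.ball (0 : ℂ) (((n + 1 : ℕ) : ℝ) + 2) := hUD n hzU.1
    -- the evaluation functional of `(Re h_j, g)` (★ P3-D) and its values on the family in integral form (canonical lift, ★ `quotFun_lift`)
    obtain ⟨Λ, hΛ⟩ := exists_evalCLM μ νG (n + 1 + 4) (h := fun x => (h n j x).re) (Complex.continuous_re.comp (hreg n j).1) ((hreg n j).2.1.comp_left Complex.zero_re) g
    have hre : ∀ x, ((((h n j x).re : ℝ)) : ℂ) = h n j x := fun x => Complex.conj_eq_iff_re.1 ((hreg n j).2.2.2.2.1 x)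
    have hΛv : ∀ s, Λ (vX n s) = ∫ y, h n j y * ((vX n s : HX (↥(maximalRealSubfield L)) L (IsCMField.complexConj L) 3 (n + 1 + 4) μ) : (quasiSplit (↥(maximalRealSubfield L)) L (IsCMField.complexConj L) 3).automorphicQuotient → ℂ) ((quasiSplit (↥(maximalRealSubfield L)) L (IsCMField.complexConj L) 3).toAutomorphicQuotient (g * y)⁻¹) ∂νG := by
      intro s
      have hmem : MemLp ((quasiSplit (↥(maximalRealSubfield L)) L (IsCMField.complexConj L) 3).quotFun (fun y : (quasiSplit (↥(maximalRealSubfield L)) L (IsCMField.complexConj L) 3).Adelic => ((vX n s : HX (↥(maximalRealSubfield L)) L (IsCMField.complexConj L) 3 (n + 1 + 4) μ) : (quasiSplit (↥(maximalRealSubfield L)) L (IsCMField.complexConj L) 3).automorphicQuotient → ℂ) ((quasiSplit (↥(maximalRealSubfield L)) L (IsCMField.complexConj L) 3).toAutomorphicQuotient y⁻¹))) 2 (μ.withDensity fun x => (((supHeight (↥(maximalRealSubfield L)) L (IsCMField.complexConj L) 3 x)⁻¹ ^ (2 * (n + 1 + 4)) : ℝ≥0) : ℝ≥0∞)) := by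
        rw [quotFun_lift]; exact Lp.memLp (vX n s)
      have htoHX : toHX (↥(maximalRealSubfield L)) L (IsCMField.complexConj L) 3 (n + 1 + 4) μ (fun y : (quasiSplit (↥(maximalRealSubfield L)) L (IsCMField.complexConj L) 3).Adelic => ((vX n s : HX (↥(maximalRealSubfield L)) L (IsCMField.complexConj L) 3 (n + 1 + 4) μ) : (quasiSplit (↥(maximalRealSubfield L)) L (IsCMField.complexConj L) 3).automorphicQuotient → ℂ) ((quasiSplit (↥(maximalRealSubfield L)) L (IsCMField.complexConj L) 3).toAutomorphicQuotient y⁻¹)) hmem = vX n s := by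
        have key : ∀ (f : (quasiSplit (↥(maximalRealSubfield L)) L (IsCMField.complexConj L) 3).automorphicQuotient → ℂ) (hf : MemLp f 2 (μ.withDensity fun x => (((supHeight (↥(maximalRealSubfield L)) L (IsCMField.complexConj L) 3 x)⁻¹ ^ (2 * (n + 1 + 4)) : ℝ≥0) : ℝ≥0∞))), f = ((vX n s : HX (↥(maximalRealSubfield L)) L (IsCMField.complexConj L) 3 (n + 1 + 4) μ) : (quasiSplit (↥(maximalRealSubfield L)) L (IsCMField.complexConj L) 3).automorphicQuotient → ℂ) → hf.toLp f = vX n s := by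
          rintro f hf rfl; exact Lp.toLp_coeFn _ _
        exact key _ hmem (quotFun_lift _)
      have e := (hΛ (fun y : (quasiSplit (↥(maximalRealSubfield L)) L (IsCMField.complexConj L) 3).Adelic => ((vX n s : HX (↥(maximalRealSubfield L)) L (IsCMField.complexConj L) 3 (n + 1 + 4) μ) : (quasiSplit (↥(maximalRealSubfield L)) L (IsCMField.complexConj L) 3).automorphicQuotient → ℂ) ((quasiSplit (↥(maximalRealSubfield L)) L (IsCMField.complexConj L) 3).toAutomorphicQuotient y⁻¹)) (lift_quotientSubgroup_mul _) hmem).2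
      rw [htoHX] at e
      rw [e]; simp only [hre]
    have hev : Gf (some g) =ᶠ[𝓝[≠] z] fun s => (∫ x, h n j x * (((borelHeight x : ℝ≥0) : ℝ) : ℂ) ^ s ∂νG)⁻¹ * Λ (vX n s) := by
      have h1 := hGF (some g) (n + 1) (Nat.le_add_left 1 n) z hzb
      simp only [hFb, Option.elim_some, Nat.add_sub_cancel] at h1
      exact h1.trans ((hgerm n g j z hzU.1 hne).trans (Eventually.of_forall fun s => by simp only [hΛv]))
    have hĥc : Continuous fun s : ℂ => (∫ x, h n j x * (((borelHeight x : ℝ≥0) : ℝ) : ℂ) ^ s ∂νG) := (differentiable_integral_mul_borelHeight_cpow νG (hreg n j).1 (hreg n j).2.1).continuous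
    have hRc : ContinuousAt (fun s => (∫ x, h n j x * (((borelHeight x : ℝ≥0) : ℝ) : ℂ) ^ s ∂νG)⁻¹ * Λ (vX n s)) z :=
      (hĥc.continuousAt.inv₀ hne).mul (Λ.continuous.continuousAt.comp ((hvXd n).continuousOn.continuousAt ((hUo n).mem_nhds hzU.1)))
    have huniq := tendsto_nhds_unique ((hGan (some g) z hzP).continuousAt.continuousWithinAt.tendsto.congr' hev) hRc.continuousWithinAt.tendsto
    rw [huniq, hΛv]
  -- ── (E4) continuity in `g` off `P`: on the Godement half-plane `Ec z = E_z` (★ regularity₃); elsewhere (E5) + ★ X2a `continuous_integral_mul_lift` on the ball of index `max 1 ⌈‖z‖⌉₊ − 1` ──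
  have hE4 : ∀ z : ℂ, z ∉ P → Continuous fun g => Gf (some g) z := by
    intro z hzP
    rcases hPU z hzP with hz1 | ⟨hzU, -⟩
    · rw [hEcE z hz1]; exact continuous_eisensteinSeriesU_flatSectionU_cm_three L hz1 (φ := fun _ : (quasiSplit (↥(maximalRealSubfield L)) L (IsCMField.complexConj L) 3).Adelic => φ₀) continuous_const (M := ‖φ₀‖) fun _ => le_rfl
    · obtain ⟨j, hj⟩ := hcov (max 1 ⌈‖z‖⌉₊ - 1) z (hUD (max 1 ⌈‖z‖⌉₊ - 1) hzU.1)
      rw [show (fun g => Gf (some g) z) = _ from funext fun g => hE5 (max 1 ⌈‖z‖⌉₊ - 1) j z hzU hzP hj g]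
      exact continuous_const.mul (continuous_integral_mul_lift μ νG (max 1 ⌈‖z‖⌉₊ - 1 + 1 + 4) (Lp.memLp (vX (max 1 ⌈‖z‖⌉₊ - 1) z)) (hreg (max 1 ⌈‖z‖⌉₊ - 1) j).1 (hreg (max 1 ⌈‖z‖⌉₊ - 1) j).2.1)
  -- ── (E3) the constant-term link on the Godement half-plane `{2 < Re}` (★ (Ξ₂)₃ identified) ──
  have hE3 : ∀ z : ℂ, 2 < z.re → ∀ g : (quasiSplit (↥(maximalRealSubfield L)) L (IsCMField.complexConj L) 3).Adelic, borelConstantTerm ν 𝓕 (fun g => Gf (some g) z) g =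
      φ₀ * (((borelHeight g : ℝ) : ℂ) ^ z + Gf none z * ((borelHeight g : ℝ) : ℂ) ^ (2 - z)) := fun z hz g => by
    rw [hEcE z hz, hcc z hz, borelConstantTerm_sphericalEisenstein_cm_three L ν h𝓕N h𝓕c φ₀ hz g]
  -- ── assembly ──
  refine ⟨fun z g => Gf (some g) z, P, Gf none, I, hI, η, h, a, κ, T, fun n => U n ∩ U₁ n, vX, cc,
    fun g => hGNF (some g), hEcE, hPc, hPcd, hPre, hPU, fun g z hz => hGan (some g) z hz, hE4, hGNF none, fun z hz => hGan none z hz, hcc, hE3, fun n => ?_⟩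
  exact ⟨hη n, hhdef n, hreg n, hcov n, ha n, hκ1 n, hdist n, hT n, (hUo n).inter (hUo₁ n), fun z hz => hUD n hz.1,
    fun z₀ hz₀ => mem_closure_iff_frequently.2 (((hUcd n z₀ hz₀).and (hUcd₁ n z₀ hz₀)).frequently.filter_mono nhdsWithin_le_nhds),
    fun z₀ hz₀ => (hUcd n z₀ hz₀).and (hUcd₁ n z₀ hz₀), (hvXd n).mono Set.inter_subset_left, hvXm n, (hccd n).mono Set.inter_subset_left,
    fun z hz hz1 => hgod n z hz.1 hz1, fun z hz i => heig n z hz.1 i, ⟨hb n, α₁ n, α₂ n, hα₁ n, hα₂ n, hα₂ne n, fun z hz => hsys n z hz.1⟩,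
    fun j z hz hzP hne g => hE5 n j z hz hzP hne g⟩

end Summit.HodgeConjecture.HodgeConjecture.Cruxes.H413.K2E1SphericalEisensteinMeromorphicExportsU3Global

end
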